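import Summits.NavierStokesRegularity.NavierStokesRegularity.Theses.HiddenConvexityPressureFloor
import Literature.Analysis.FluidPDE.TypeIAncientMild
import Literature.Analysis.FluidPDE.PressureRepresentation
import Literature.Analysis.FluidPDE.SuitableWeak

/-!
# `OneSidedHessianCriterion` (stmt-NavierStokesRegularity-2962) — birth skeleton `Lines/birth.lean`

Route `HiddenConvexityPressureFloor`, crux C (rank 3): for a finite-energy (Leray–Hopf) classical
solution of unforced Navier–Stokes on `ℝ³ × [0,T)` from a rapidly decaying datum, an admissible
semiconcavity modulus `k ≥ 0` of the normalised pressure slices (`x ↦ p̃(t,x) − k(t)/2‖x‖²`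
concave) with `∫₀ᵀ √k dt < ∞` forces a classical extension past `T`.

LINE (Type-I dichotomy + pressureless rigidity).  Argue by contradiction on the extension.

* `stub_typeI_of_integrableModulus` (HARDEST, the new mechanism): under the hypothesis of C, a
  maximal solution (no extension past `T`) blows up at most at the Type I rate
  `‖u(t)‖_∞ ≤ C (T−t)^{-1/2}` (`IsTypeIBlowup u T`).  It is the weakening of the sibling crux
  `TypeILiouville.TypeIliouvilleNoTypeII` (stmt-0056) by the one-sided Hessian hypothesis: what must
  be excluded is a strain-dominated Type II collapse whose pressure wells stay integrably shallow in
  curvature (`∇²p̃ ≤ kI` caps only `|ω|²/2 − |S|² = Δp̃ ≤ 3k`).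
* `stub_pressurelessTypeIZoom` (zoom, M/L): under the same hypothesis a maximal Type I solution
  generates, by the KNSS Type-I zoom in the Oseen gauge (tree: `KNSS2009_blowup_generates_ancient_holds`,
  `KNSSTypeIRateMild*`, class `IsTypeIAncientMild`), a NONTRIVIAL Type-I ancient mild solution `v`
  which is PRESSURELESS: `pressureSource (v s) ≡ 0` (`= ∂ᵢ∂ⱼ(vᵢvⱼ) = −Δ` of its Riesz pressure).
  Mechanism: the rescaled moduli `λ⁴ k(t_k + λ² s)` have `∫ λ²√k → 0` on every backward window
  (absolute continuity of `∫√k`), semiconcavity passes to the limit modulo constants (pair with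
  mean-zero second derivatives of test functions, `RᵢRⱼ∂ₑₑφ ∈ L¹`), so the limit Riesz pressure is
  concave on a.e. slice; a concave `BMO(ℝ³)` function is constant (ball averages of a concave
  function with a nonzero supergradient decrease linearly along a ray, BMO averages grow only
  logarithmically), hence harmonic, hence `pressureSource ≡ 0` (continuity in `s`).
* `stub_pressurelessTypeILiouville` (rigidity, M): a pressureless element of the Type-I ancient
  mild class vanishes.  Mechanism: in the Oseen gauge the pressure is `RᵢRⱼ(vᵢvⱼ) ∈ BMO`, harmonic
  by hypothesis, hence constant, so each component solves `∂ₛθ + v·∇θ = Δθ` classically with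
  bounded smooth drift; the whole-space maximum principle gives `‖v(s₁)‖_∞ ≤ ‖v(s₀)‖_∞ ≤ C/√(−s₀) → 0`
  as `s₀ → −∞`.  (The gauge matters: the parasitic `v = b(s)` of the duality-form class is excluded,
  cf. `IsTypeIAncientMild.eq_zero_of_slice_const`.)  Strictly weaker than the open crux
  `SymmetryModuliCount.TypeIAncientLiouville` (stmt-4050).

Glue `OneSidedHessianCriterion_of : OneSidedHessianCriterion` (no hypotheses, no direct `sorry`; it invokes the three
named stubs): by contradiction, stub 1 gives the Type I rate, stub 2 a nontrivial pressureless Type-I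
ancient mild solution, stub 3 kills it.

Disproof used: none (no `Disproof.lean` / Negative lemma filed for this crux as of 2026-08-17;
`ledger negatives --problem NavierStokesRegularity`: 4 entries, none about one-sided pressure,
Type-I rates or the class `IsTypeIAncientMild` itself — stmt-4055 concerns the LINEARISED moduli
count around such drifts).
-/

noncomputable section

-- the summit and its single problem share the name `NavierStokesRegularity` (D-0017 nested layout)
set_option linter.dupNamespace false

namespace Summit.NavierStokesRegularity.NavierStokesRegularity.Cruxes.OneSidedHessianCriterion.Birth

open Set MeasureTheory
open Literature.Analysis.FluidPDE

/-! ## Stubs -/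

/-- STUB 1 (hardest; the new mechanism).  **An integrable one-sided Hessian modulus forbids Type II.**
For `ν, T > 0` and a MAXIMAL classical solution `(u, p)` of unforced Navier–Stokes on `ℝ³ × [0, T)`
(no classical extension past `T`) which is Leray–Hopf from its rapidly decaying datum `u 0`: if the
normalised pressure slices admit a semiconcavity modulus `k ≥ 0` with `∫₀ᵀ √k < ∞`, then the
blow-up at `T` is of Type I (`‖u(t,x)‖ ≤ C/√(T − t)` for `t < T` close to `T`). -/
theorem stub_typeI_of_integrableModulus :
    ∀ (ν T : ℝ), 0 < ν → 0 < T →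
      ∀ (u : ℝ → EuclideanSpace ℝ (Fin 3) → EuclideanSpace ℝ (Fin 3))
        (p : ℝ → EuclideanSpace ℝ (Fin 3) → ℝ),
        IsMaximalSmoothSolution ν 0 u p T → IsLerayHopfOn T ν 0 (u 0) u →
          HasRapidSpatialDecay (u 0) →
            (∃ k : ℝ → ℝ, (∀ t ∈ Set.Ico 0 T, 0 ≤ k t ∧ ConcaveOn ℝ Set.univ
                (fun x : EuclideanSpace ℝ (Fin 3) => normalisedPressure (u t) x - k t / 2 * ‖x‖ ^ 2)) ∧
              IntegrableOn (fun t => Real.sqrt (k t)) (Set.Ico 0 T)) →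
              IsTypeIBlowup u T := by
  sorry

/-- STUB 2 (zoom).  **A maximal Type-I solution with integrable modulus generates a nontrivial
PRESSURELESS Type-I ancient mild solution.**  Same hypotheses plus the Type I rate at `T`: there are
`C` and `v` in the Oseen-gauge Type-I ancient mild class (`IsTypeIAncientMild C v`: smooth on
`(−∞,0) × ℝ³`, divergence-free slices, Oseen integral equation between all `s < t < 0`,
`‖v(s,y)‖ ≤ C/√(−s)`) with `v` not identically zero and `pressureSource (v s) y = ∂ᵢ∂ⱼ(vᵢvⱼ)(s,y) = 0`
for all `s < 0`, `y` (the KNSS Type-I zoom; the rescaled moduli `λ⁴k(t_k + λ²·)` vanish in `L¹_loc`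
after taking square roots, so the limit Riesz pressure is concave modulo constants on a.e. slice,
and a concave `BMO` function on `ℝ³` is constant). -/
theorem stub_pressurelessTypeIZoom :
    ∀ (ν T : ℝ), 0 < ν → 0 < T →
      ∀ (u : ℝ → EuclideanSpace ℝ (Fin 3) → EuclideanSpace ℝ (Fin 3))
        (p : ℝ → EuclideanSpace ℝ (Fin 3) → ℝ),
        IsMaximalSmoothSolution ν 0 u p T → IsLerayHopfOn T ν 0 (u 0) u →
          HasRapidSpatialDecay (u 0) →
            (∃ k : ℝ → ℝ, (∀ t ∈ Set.Ico 0 T, 0 ≤ k t ∧ ConcaveOn ℝ Set.univ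
                (fun x : EuclideanSpace ℝ (Fin 3) => normalisedPressure (u t) x - k t / 2 * ‖x‖ ^ 2)) ∧
              IntegrableOn (fun t => Real.sqrt (k t)) (Set.Ico 0 T)) →
              IsTypeIBlowup u T →
                ∃ (C : ℝ) (v : ℝ → EuclideanSpace ℝ (Fin 3) → EuclideanSpace ℝ (Fin 3)),
                  IsTypeIAncientMild C v ∧ (¬ ∀ s < 0, ∀ y, v s y = 0) ∧
                    ∀ s < 0, ∀ y, pressureSource (v s) y = 0 := by
  sorry

/-- STUB 3 (rigidity).  **Pressureless Type-I ancient mild solutions are trivial.**  If `v` is in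
the Oseen-gauge Type-I ancient mild class with constant `C` and `∂ᵢ∂ⱼ(vᵢvⱼ) ≡ 0` on every slice
(its Riesz pressure `RᵢRⱼ(vᵢvⱼ) ∈ BMO` is harmonic, hence constant), then `v ≡ 0` on `(−∞, 0) × ℝ³`
(componentwise drift–heat equation, whole-space maximum principle, and the decay `C/√(−s) → 0` as
`s → −∞`; the gauge excludes the parasitic `v = b(s)`). -/
theorem stub_pressurelessTypeILiouville :
    ∀ (C : ℝ) (v : ℝ → EuclideanSpace ℝ (Fin 3) → EuclideanSpace ℝ (Fin 3)),
      IsTypeIAncientMild C v → (∀ s < 0, ∀ y, pressureSource (v s) y = 0) →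
        ∀ s < 0, ∀ y, v s y = 0 := by
  sorry

/-! ## Glue -/

/-- **The three stubs imply the crux `OneSidedHessianCriterion` (concluded BY NAME; no hypotheses —
the only `sorry`s of the file sit inside the three `stub_*` declarations it invokes).**  Logical shape:
`stub_typeI_of_integrableModulus → stub_pressurelessTypeIZoom → stub_pressurelessTypeILiouville → C`.
Proof: by contradiction, a solution with an integrable modulus and no extension past `T` is maximal,
hence Type I (stub 1), hence generates a nontrivial pressureless Type-I ancient mild solution
(stub 2), which stub 3 forces to vanish. -/
theorem OneSidedHessianCriterion_of :
    _root_.Summit.NavierStokesRegularity.NavierStokesRegularity.Theses.HiddenConvexityPressureFloor.OneSidedHessianCriterion := by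
  intro ν T hν hT u p hcl hLH hdec hk
  by_contra hext
  have hmax : IsMaximalSmoothSolution ν 0 u p T := ⟨hcl, hext⟩
  have hI : IsTypeIBlowup u T :=
    stub_typeI_of_integrableModulus ν T hν hT u p hmax hLH hdec hk
  obtain ⟨C, v, hv, hnontriv, hsrc⟩ :=
    stub_pressurelessTypeIZoom ν T hν hT u p hmax hLH hdec hk hI
  exact hnontriv (stub_pressurelessTypeILiouville C v hv hsrc)

end Summit.NavierStokesRegularity.NavierStokesRegularity.Cruxes.OneSidedHessianCriterion.Birth
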